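import Summits.QuantumFields.YangMills.Theorems.BalabanUVNodesN15KingModelFullPropagatorBgLetters
import Summits.QuantumFields.YangMills.Theorems.BalabanUVNodesN15TwoGridLandauMassless
import Summits.QuantumFields.YangMills.Theorems.BalabanUVNodesN15FullPropagatorExactSiteSocketWords
import HarnessLib

/-!
# Route «BalabanUVNodes», cluster K4 «SpineRates» — node N15 = NE2: THE SITE LAYER WITH THE BACKGROUND LIVE IN THE TwoGrid ENTRY CURRENCY, VII — THE GENUINE MASSLESS
# `U ≡ 1` SCALAR SITE PROPAGATOR `G′_k = (−Δ^η + a_kQ′*Q′)⁻¹` AS A BLOCK-LETTER LAYER: size on both grids and the two-grid defect through King's pairing, uniformly on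
# the torus family of record — the mass-uniform King-rung letters passed to `m² = 0`

Cell `pub-ymgap`, WIDTH SEAT `pub-ymgap-dag-n15-w1` (generation 2; director-ym №197 ∕ HUMAN RULING D-0149; chair R455 (A) ∕ R461; plan g81 `W-SEAT-START-LIST.md` v8 §n15, g0's ASK-NEXT
pub-ymgap INBOX l.26717 ∕ LOCATED l.27147 — bus CLAIM-1 = INTENT-1 l.27487).  `bears_on: R4∕N15 · K3⁷ SpineGivenEndpointR13SepCoPH (stmt-QuantumFields-20544)`.  Filed `--kind proof --supports
stmt-QuantumFields-20544 --as helper` — COUNT-NEUTRAL.  THEOREMS ONLY (0 `def`, 0 `sorry`).  Imports dag-n15-e part Σ-a `…N15KingModelFullPropagatorBgLetters` (`kingGOp`, `underPtN`,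
`hasMaj_kingGOp`, `hasMaj_idef_kingGOp`: the `U ≡ 1` size and η-defect letters of King's full `A = 0` propagator `(fineOp (L^K) M a_K (L^K)² m²)⁻¹`, MASS-UNIFORM on `0 < m² ≤ m₀²`)
and dag-n15-a part 51 `…N15TwoGridLandauMassless` (`isUnit_det_fineOp_zero`, `fineOp_eq_add_mass`, `abs_le_of_Ioc`: the `m² → 0⁺` device; through it part 50 `KRe_torIdx_eq_minimiser`
and part 49 `gram_entry_eq`) and this seat's part V `…N15FullPropagatorExactSiteSocketWords` (`siteEntries`; through it dag-n15-c S2 `siteForm₀`, n15-b `fibAvg`) BY NAME; nothing in the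
tree is modified.

WHY.  Parts II∕IV∕V of this seat's site-socket road (`…N15FullPropagatorExactSiteSocket(S∕Words)`) take the `U ≡ 1` SCALAR layer of the two runs as HYPOTHESES — `Gc ≤ β·e^{−δd}` on
King's unit blocks `blockOf (L^k) M` of the sized carrier `unitTorusGeoS`, `Gf ≤ β·e^{−δd}` on `blockOf ∘ π`, `𝔇^π(Gf, Gc) ≤ m₀·(L^k)^{−γ_P}·e^{−δd}` through King's pairing `π`
(part V `siteLetters_of_dressedLetters`, hypothesis `hL`, first three conjuncts).  The HONEST `U ≡ 1` member of the site form `Q′G′²Q′* = qggqRe (L^k) (aK a L k) M` the sockets perturb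
is the SCALAR propagator `G′_k = (−Δ^η + a_kQ′*Q′)⁻¹` at `m² = 0` (b04 `K_T = G′Q′*`; dag-n15-a part 50 `KRe_torIdx_eq_minimiser`, `reM_greenOp_eq_fineOp`: b05's `Re(Δ + aQ′*Q′) = fineOp n M a n² 0`),
i.e. `kingGOp L a 0 k (L^k) M = (fineOp (L^k) M (aK a L k) (L^k)² 0)⁻¹` — NOT [B5]'s `G₀ = (Δ + aQ*Q)⁻¹` of (1.132) with the VECTOR average (1.18) (`B5G0SettingTorus.famG0Top`), which g0's
LOCATED note l.27147 named (corrected on the bus l.27487).  Its block letters are IN THE TREE for every POSITIVE mass, with constants uniform on `(0, m₀²]` (dag-n15-e Σ-a, King's model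
being massive); the massless operator exists (`isUnit_det_fineOp_zero`) and the matrix inverse is continuous there, so the letters pass to `m² = 0` — a block majorant between sharp block
sup sizes is a CLOSED condition in the operator.  THIS FILE proves exactly that and nothing else.

CONTENTS ([folklore] bookkeeping + two landed theorems BY NAME).
* §1 ★ `hasMaj_ofBlocks_of_massLimit` — `HasMaj (ofBlocks g blk₁) (ofBlocks g blk₂) (T m) K` for all `m ∈ (0, m₀]` and `m ↦ (T m) μ x` continuous at `0` ⟹ `HasMaj … (T 0) K`.
* §2 `continuousAt_fineOp_inv_mulVec_mass` (`m² ↦ (A₀(a, N², m²)⁻¹λ)(x)` continuous at `0`, `a > 0`), `continuousAt_kingGOp_mass` (`K ≥ 1`), `continuousAt_idef_kingGOp_mass` (the η-defect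
  `𝔇^π(G′, G)λ x` of the two runs).
* §3 ★★ **`kingGOp_massless_letters`**: for odd `L ≥ 3`, `a > 0`, `0 ≤ γ < 1` there are `β, δ, m₀ > 0` such that for every `K ≥ 1`, `n ≥ 1`, cube `2L^e`, size datum `Msz`:
  `G = kingGOp L a 0 K (L^K) M ≤ β·e^{−δ|y−y′|_T}` (coarse, blocks `blockOf`), `G′ = kingGOp L a 0 (K+n) (L^nL^K) M ≤ β·e^{−δ|y−y′|_T}` (fine, blocks `blockOf ∘ underPtN`), and
  `𝔇(G′, G) = G′∘τ − τ∘G ≤ m₀·(L^K)^{−γ∕2}·e^{−δ|y−y′|_T}` (`τλ = λ∘underPtN`) — the three `Gc∕Gf` letters of part V's `hL` for the GENUINE massless scalar layer, ONE `(β, δ, m₀)`;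
  `kingGOp_zero_apply` (the massless member unfolded).
* §4 ★★ **THE HONEST DICTIONARY `siteEntries_siteForm₀_fineOp_inv`**: `siteEntries M (siteForm₀ (blockOf n M) (A₀(a, n², 0)⁻¹)) = qggqRe n a M` for every `n ≥ 1`, `a > 0`, `M` — the `U ≡ 1`
  site form `Q′G′²Q′*` of (1.45) that the sockets of parts II∕IV perturb (`siteEx = (qggqRe + P)⁻¹`) IS the lineage's `siteForm₀ = Q∘G′∘G′∘Q*` (`Q` = block mean `fibAvg blockOf`,
  `Q* = pull blockOf`) of THIS massless layer — b05's Gram identity `gram_entry_eq`, `K_T(x, b) = (A₀⁻¹1_{B(b)})(x)` (`KRe_torIdx_eq_inv_mulVec_indicator`, from part 50 + King's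
  `minimiser = a·A₀⁻¹(φ∘blockOf)`), the symmetry of `A₀⁻¹` and `|B(b)| = n^{d+1}`; `siteEntries_siteForm₀_kingGOp_zero` (the same for `kingGOp L a 0 K N M`, coupling `a_K`).  So part V's
  `sitePert365 blockOf G′ X(U)` perturbs LITERALLY [B5]'s `Q′G′²Q′*` when `G′` is this file's layer — the «lane's dictionary» parts V∕VI left open is closed here.

HONEST FRAMING.  Count-neutral helper; NO new estimate (closedness + continuity applied to dag-n15-e Σ-a at `m₀² := 1`); `U ≡ 1` linear theory on the finite tori of record `M_μ = 2L^e`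
with King's running couplings `a_k = aK a L k` ([King1986] (2.15) = [B4] (1.6)); §4 is exact finite-dimensional linear algebra; the dressed layer `X(U)` and the averaging species
that make part V's socket fire on a lane's family are NOT here (next files).  NOT [B9] Thm 3.2 at a general (3.35)-regular `U` (NE2⁺ NOT PRINTED as an η-rate); Node 00's [B9]
layers of record are residual — **N15 is NOT discharged** (typed 28∕28 · discharged 5∕27 of record unchanged); one finite four-torus programme at fixed `ε` — NOT ℝ⁴, NOT infinite volume,
NOT OS, NOT a mass gap, NOT Clay; R4 closes the conditional finite-𝕋⁴ rung `BalabanLadder.UV` only.  Restate-immune (no Theses import).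
-/

set_option autoImplicit false

noncomputable section

open scoped BigOperators Matrix Topology
open Finset Filter

namespace Summit.QuantumFields.YangMills.BalabanUVNodes.N15.SiteLayerBg

open Literature.MathematicalPhysics.QuantumFieldTheory.Balaban1983to89
open Literature.MathematicalPhysics.QuantumFieldTheory.Balaban1983to89.B11SectG (BlockNorm HasMaj)
open Literature.MathematicalPhysics.QuantumFieldTheory.Balaban1983to89.B11AxialTransport190 (abs_le_loc_ofBlocks loc_ofBlocks_le)
open Literature.MathematicalPhysics.QuantumFieldTheory.Balaban1983to89.T4EtaRateDefect (idef idef_apply)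
open Literature.MathematicalPhysics.QuantumFieldTheory.Balaban1983to89.T4EtaRateCoeffDefect (pull pull_apply)
open Literature.MathematicalPhysics.QuantumFieldTheory.Balaban1983to89.B5Prop11Plancherel (Tor fine)
open Literature.MathematicalPhysics.QuantumFieldTheory.King1986 (aK aK_pos)
open Literature.MathematicalPhysics.QuantumFieldTheory.King1986.Torus (fineOp blockOf tdistT tdistT_nonneg)
open Summit.QuantumFields.YangMills.BalabanUVNodes.N15.VectorPiece (unitTorusGeoS)
open Literature.MathematicalPhysics.QuantumFieldTheory.Balaban1983to89.T4EtaRateDefectSite (entry entry_apply)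
open Literature.MathematicalPhysics.QuantumFieldTheory.Balaban1983to89.T4EtaRateCoeffDefect (fibre mem_fibre)
open Literature.MathematicalPhysics.QuantumFieldTheory.Balaban1983to89.B5QGGQ145Bounds (Idx qggqRe)
open Literature.MathematicalPhysics.QuantumFieldTheory.Balaban1983to89.B5QGGQ145Factor (KRe)
open Literature.MathematicalPhysics.QuantumFieldTheory.Balaban1983to89.B5PBridgeProjection (torIdx)
open Literature.MathematicalPhysics.QuantumFieldTheory.Balaban1983to89.B6UnitTorusCarrier (card_fibre_blockOf)
open Literature.MathematicalPhysics.QuantumFieldTheory.King1986.Torus (Qmat minimiser transpose_Qmat_mulVec)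
open Summit.QuantumFields.YangMills.BalabanUVNodes.N15.TwoGrid (fineOp_eq_add_mass isUnit_det_fineOp_zero abs_le_of_Ioc KRe_torIdx_eq_minimiser gram_entry_eq)
open Summit.QuantumFields.YangMills.BalabanUVNodes.N15.SiteLayer (siteForm₀)
open Summit.QuantumFields.YangMills.BalabanUVNodes.N15KingModelRung.Curved (kingGOp kingGOp_apply underPtN hasMaj_kingGOp hasMaj_idef_kingGOp fineOp_inv_transpose)

variable {d : ℕ}

/-! ## §1 A block majorant between sharp block sizes is a closed condition in the operator: passage to the limit `m² → 0⁺` -/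

section Closed

variable {g : B6.Geometry} {X₁ X₂ : Type} [Fintype X₁] [Fintype X₂]

/-- ★ **`HasMaj` PASSES TO THE MASSLESS LIMIT.**  A one-parameter family of operators `T m` with ONE block majorant `K` between the sharp block sup sizes for every
`m ∈ (0, m₀]`, each matrix element `m ↦ (T m μ)(x)` continuous at `m = 0` ⟹ `T 0` has the same majorant (the sharp block size is a finite sup of absolute values of entries,
and a bound uniform on `(0, m₀]` passes to `0` by continuity — dag-n15-a part 51 `abs_le_of_Ioc`). [folklore] -/
theorem hasMaj_ofBlocks_of_massLimit (blk₁ : X₁ → g.Site) (blk₂ : X₂ → g.Site) (T : ℝ → (X₁ → ℝ) →ₗ[ℝ] (X₂ → ℝ)) (K : g.Site → g.Site → ℝ) {m0 : ℝ}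
    (hm0 : 0 < m0) (hT : ∀ (μ : X₁ → ℝ) (x : X₂), ContinuousAt (fun m : ℝ => T m μ x) 0)
    (h : ∀ m : ℝ, 0 < m → m ≤ m0 → HasMaj (BlockNorm.ofBlocks g blk₁) (BlockNorm.ofBlocks g blk₂) (T m) K) :
    HasMaj (BlockNorm.ofBlocks g blk₁) (BlockNorm.ofBlocks g blk₂) (T 0) K := by
  intro y' μ hμ y
  have hB : 0 ≤ K y y' * (BlockNorm.ofBlocks g blk₁).loc y' μ :=
    ((BlockNorm.ofBlocks g blk₂).loc_nonneg y _).trans (h m0 hm0 le_rfl y' μ hμ y)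
  refine loc_ofBlocks_le (g := g) blk₂ _ hB fun x hx => ?_
  exact abs_le_of_Ioc (g := fun m : ℝ => T m μ x) hm0 (hT μ x) fun m hm hmm =>
    (abs_le_loc_ofBlocks (g := g) blk₂ (T m μ) hx).trans (h m hm hmm y' μ hμ y)

end Closed

/-! ## §2 Continuity in the mass at `m² = 0` of King's full propagator and of its two-grid defect -/

section Continuity

variable (M : Fin (d + 1) → ℕ) [∀ μ, NeZero (M μ)] (N : ℕ) [NeZero N]

/-- `m² ↦ (A₀(a, N², m²)⁻¹λ)(x)` is continuous at `m² = 0` (`a > 0`): the massless operator `A₀(a, N², 0) = Re(Δ + aQ′*Q′)` is invertible (part 51 `isUnit_det_fineOp_zero`) and the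
matrix inverse is continuous there (part 51's `continuousAt_minimiser_mass`, source `Q_K^*φ` replaced by a general `λ`). [cite: King1986, (4.1)–(4.5) p.670; Balaban1984PropagatorsI, p.25 («its inverse is a bounded operator G′»)] -/
theorem continuousAt_fineOp_inv_mulVec_mass {a : ℝ} (ha : 0 < a) (lam : Tor (fine N M) → ℝ) (x : Tor (fine N M)) :
    ContinuousAt (fun m2 : ℝ => ((fineOp N M a ((N : ℝ) ^ 2) m2)⁻¹ *ᵥ lam) x) 0 := by
  classical
  have haff : Continuous fun m2 : ℝ => fineOp N M a ((N : ℝ) ^ 2) 0 + m2 • (1 : Matrix (Tor (fine N M)) (Tor (fine N M)) ℝ) :=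
    continuous_const.add (continuous_id.smul continuous_const)
  have hinv : ContinuousAt (fun A : Matrix (Tor (fine N M)) (Tor (fine N M)) ℝ => A⁻¹) (fineOp N M a ((N : ℝ) ^ 2) 0) := by
    refine continuousAt_matrix_inv _ ?_
    obtain ⟨u, hu⟩ := isUnit_det_fineOp_zero M N ha
    rw [← hu]
    exact NormedRing.inverse_continuousAt u
  have hF : ContinuousAt (fun m2 : ℝ => (fineOp N M a ((N : ℝ) ^ 2) m2)⁻¹) 0 := by
    have e : (fun m2 : ℝ => (fineOp N M a ((N : ℝ) ^ 2) m2)⁻¹) = (fun A : Matrix (Tor (fine N M)) (Tor (fine N M)) ℝ => A⁻¹) ∘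
        fun m2 : ℝ => fineOp N M a ((N : ℝ) ^ 2) 0 + m2 • (1 : Matrix (Tor (fine N M)) (Tor (fine N M)) ℝ) := by
      funext m2
      show _ = (fineOp N M a ((N : ℝ) ^ 2) 0 + m2 • (1 : Matrix (Tor (fine N M)) (Tor (fine N M)) ℝ))⁻¹
      rw [← fineOp_eq_add_mass]
    rw [e]
    refine ContinuousAt.comp ?_ haff.continuousAt
    simpa using hinv
  have hlin : Continuous fun A : Matrix (Tor (fine N M)) (Tor (fine N M)) ℝ => (A *ᵥ lam) x := by
    simp only [Matrix.mulVec, dotProduct]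
    exact continuous_finsetSum Finset.univ fun j _ => (continuous_apply_apply x j).mul continuous_const
  exact hlin.continuousAt.comp hF

variable (L : ℕ)

/-- `m² ↦ (Gλ)(x) = (A₀(a_K, N², m²)⁻¹λ)(x)` for King's full propagator `kingGOp L a m² K N M` is continuous at `m² = 0` (`a > 0`, `L > 1`, `K ≥ 1`, so `a_K > 0`).
[cite: King1986, (2.15) p.653, (4.1)–(4.5) p.670] -/
theorem continuousAt_kingGOp_mass (hL : 1 < L) {a : ℝ} (ha : 0 < a) {K : ℕ} (hK : 1 ≤ K) (lam : Tor (fine N M) → ℝ) (x : Tor (fine N M)) :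
    ContinuousAt (fun m2 : ℝ => kingGOp L a m2 K N M lam x) 0 := by
  have hLr : (1 : ℝ) < (L : ℝ) := by exact_mod_cast hL
  simp only [kingGOp_apply]
  exact continuousAt_fineOp_inv_mulVec_mass M N (aK_pos ha hLr hK) lam x

/-- `m² ↦ (𝔇^π(G′, G)λ)(x) = (G′(λ∘π))(x) − (Gλ)(πx)` for the two runs `G′ = kingGOp L a m² (K+n) (L^nL^K) M`, `G = kingGOp L a m² K (L^K) M` of King's full propagator is
continuous at `m² = 0`. [cite: King1986, p.664 (pairing), (4.1)–(4.5) p.670] -/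
theorem continuousAt_idef_kingGOp_mass [NeZero L] (hL : 1 < L) {a : ℝ} (ha : 0 < a) {K : ℕ} (hK : 1 ≤ K) (n : ℕ) (lam : Tor (fine (L ^ K) M) → ℝ) (x' : Tor (fine (L ^ n * L ^ K) M)) :
    ContinuousAt (fun m2 : ℝ => idef (pull (underPtN L K n M)) (pull (underPtN L K n M)) (kingGOp L a m2 (K + n) (L ^ n * L ^ K) M)
      (kingGOp L a m2 K (L ^ K) M) lam x') 0 := by
  simp only [idef_apply, Pi.sub_apply, pull_apply]
  exact (continuousAt_kingGOp_mass M (L ^ n * L ^ K) L hL ha (hK.trans (Nat.le_add_right K n)) _ x').sub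
    (continuousAt_kingGOp_mass M (L ^ K) L hL ha hK lam _)

end Continuity

/-! ## §3 ★★ The massless `U ≡ 1` scalar site layer: the three letters at `m² = 0`, uniformly on the torus family of record -/

section Letters

variable (L : ℕ) [NeZero L]

omit [NeZero L] in
/-- the massless member unfolded: `(G₀λ)(x) = ((fineOp N M a_K N² 0)⁻¹λ)(x)` — `A₀(a_K, N², 0) = Re(Δ^η-lattice Laplacian·N² + a_KQ′*Q′)` is b05's GENUINE scalar `G′⁻¹` at `m² = 0`
(dag-n15-a part 50 `reM_greenOp_eq_fineOp`). [cite: Balaban1984PropagatorsI, p.25 («G′ = (Δ + aQ′*Q′)⁻¹» at (1.44)–(1.45)); King1986, (4.1)–(4.5) p.670] -/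
theorem kingGOp_zero_apply (a : ℝ) (K N : ℕ) [NeZero N] (M : Fin (d + 1) → ℕ) [∀ μ, NeZero (M μ)] (lam : Tor (fine N M) → ℝ) (x : Tor (fine N M)) :
    kingGOp L a 0 K N M lam x = ((fineOp N M (aK a L K) (((N : ℕ) : ℝ) ^ 2) 0)⁻¹ *ᵥ lam) x := rfl

/-- ★★ **THE GENUINE MASSLESS `U ≡ 1` SCALAR SITE PROPAGATOR AS A BLOCK-LETTER LAYER.**  For odd `L ≥ 3`, `a > 0`, `0 ≤ γ < 1` there are `β, δ, m₀ > 0` such that for every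
coarse scale `K ≥ 1`, every number of extra scales `n ≥ 1`, every cube `M_μ = 2L^e` and every size datum `Msz`, the massless propagators `G = (−Δ^η·N² + a_KQ′*Q′)⁻¹ = kingGOp L a 0 K (L^K) M`
(coarse run, `N = L^K`) and `G′ = kingGOp L a 0 (K+n) (L^nL^K) M` (fine run) satisfy: `G ≤ β·e^{−δ|y−y′|_T}` between the sharp sizes on King's unit blocks `blockOf (L^K) M`;
`G′ ≤ β·e^{−δ|y−y′|_T}` on the blocks `blockOf (L^K) M ∘ underPtN` (`= blockOf (L^nL^K) M`); and the two-grid defect through King's pairing `𝔇(G′, G) = G′∘τ − τ∘G ≤ m₀·(L^K)^{−γ∕2}·e^{−δ|y−y′|_T}`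
(`τλ = λ∘underPtN`) — dag-n15-e Σ-a's mass-uniform letters `hasMaj_kingGOp` ∕ `hasMaj_idef_kingGOp` on `(0, 1]` passed to `m² = 0` by §1–§2.  These are the first three conjuncts of part V's
hypothesis `hL` (`siteLetters_of_dressedLetters` ∕ `ne2PlusSite_sSiteExOn_of_dressedLetters`) for the honest `U ≡ 1` member of the site form `Q′G′²Q′*`.
[cite: Balaban1984PropagatorsI, Prop. 1.2 (1.110) p.35 (shape of the size letter), p.25; Balaban1983RegularityDecay, Theorem (1.10) p.573; King1986, Thm 3.3 (3.7) p.656, Prop. 3.8 (3.71) p.664, p.664 (pairing); Balaban1985BackgroundPropagators, Thm 3.1 (3.42) p.397 (first entry, shape)] -/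
theorem kingGOp_massless_letters (hLodd : Odd L) (hL : 2 ≤ L) {a : ℝ} (ha : 0 < a) {γ : ℝ} (hγ0 : 0 ≤ γ) (hγ1 : γ < 1) :
    ∃ β δ m₀ : ℝ, 0 < β ∧ 0 < δ ∧ 0 < m₀ ∧ ∀ (K : ℕ), 1 ≤ K → ∀ (n : ℕ), 1 ≤ n → ∀ (e : ℕ) (M : Fin (d + 1) → ℕ) [∀ μ, NeZero (M μ)],
      (∀ μ, M μ = 2 * L ^ e) → ∀ (Msz : ℝ),
      HasMaj (BlockNorm.ofBlocks (unitTorusGeoS L K M Msz) (blockOf (L ^ K) M)) (BlockNorm.ofBlocks (unitTorusGeoS L K M Msz) (blockOf (L ^ K) M))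
          (kingGOp L a 0 K (L ^ K) M) (fun y y' => β * Real.exp (-(δ * tdistT M y y')))
      ∧ HasMaj (BlockNorm.ofBlocks (unitTorusGeoS L K M Msz) (blockOf (L ^ K) M ∘ underPtN L K n M))
          (BlockNorm.ofBlocks (unitTorusGeoS L K M Msz) (blockOf (L ^ K) M ∘ underPtN L K n M))
          (kingGOp L a 0 (K + n) (L ^ n * L ^ K) M) (fun y y' => β * Real.exp (-(δ * tdistT M y y')))
      ∧ HasMaj (BlockNorm.ofBlocks (unitTorusGeoS L K M Msz) (blockOf (L ^ K) M))
          (BlockNorm.ofBlocks (unitTorusGeoS L K M Msz) (blockOf (L ^ K) M ∘ underPtN L K n M))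
          (idef (pull (underPtN L K n M)) (pull (underPtN L K n M)) (kingGOp L a 0 (K + n) (L ^ n * L ^ K) M) (kingGOp L a 0 K (L ^ K) M))
          (fun y y' => m₀ * ((L : ℝ) ^ K) ^ (-(γ / 2)) * Real.exp (-(δ * tdistT M y y'))) := by
  obtain ⟨β, δ₁, hβ, hδ₁, H1⟩ := hasMaj_kingGOp (d := d) L hLodd hL ha (zero_le_one : (0 : ℝ) ≤ 1)
  obtain ⟨m₀, δ₂, hm₀, hδ₂, H2⟩ := hasMaj_idef_kingGOp (d := d) L hLodd hL ha (zero_le_one : (0 : ℝ) ≤ 1) hγ0 hγ1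
  have hL1 : 1 < L := hL
  refine ⟨β, min δ₁ δ₂, m₀, hβ, lt_min hδ₁ hδ₂, hm₀, fun K hK n hn e M _ hM Msz => ⟨?_, ?_, ?_⟩⟩
  · -- coarse size at `m² = 0`
    have key := hasMaj_ofBlocks_of_massLimit (g := unitTorusGeoS L K M Msz) (blockOf (L ^ K) M) (blockOf (L ^ K) M)
      (fun m2 : ℝ => kingGOp L a m2 K (L ^ K) M) (fun y y' => β * Real.exp (-(δ₁ * tdistT M y y'))) one_pos
      (fun μ x => continuousAt_kingGOp_mass M (L ^ K) L hL1 ha hK μ x) fun m hm hm1 => (H1 K hK n e M hM m hm hm1 Msz).1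
    exact key.mono fun y y' => mul_le_mul_of_nonneg_left
      (Real.exp_le_exp.mpr (neg_le_neg (mul_le_mul_of_nonneg_right (min_le_left _ _) (tdistT_nonneg M y y')))) hβ.le
  · -- fine size at `m² = 0`
    have key := hasMaj_ofBlocks_of_massLimit (g := unitTorusGeoS L K M Msz) (blockOf (L ^ K) M ∘ underPtN L K n M) (blockOf (L ^ K) M ∘ underPtN L K n M)
      (fun m2 : ℝ => kingGOp L a m2 (K + n) (L ^ n * L ^ K) M) (fun y y' => β * Real.exp (-(δ₁ * tdistT M y y'))) one_pos
      (fun μ x => continuousAt_kingGOp_mass M (L ^ n * L ^ K) L hL1 ha (hK.trans (Nat.le_add_right K n)) μ x)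
      fun m hm hm1 => (H1 K hK n e M hM m hm hm1 Msz).2
    exact key.mono fun y y' => mul_le_mul_of_nonneg_left
      (Real.exp_le_exp.mpr (neg_le_neg (mul_le_mul_of_nonneg_right (min_le_left _ _) (tdistT_nonneg M y y')))) hβ.le
  · -- two-grid defect at `m² = 0`
    have hθ : 0 ≤ m₀ * ((L : ℝ) ^ K) ^ (-(γ / 2)) := mul_nonneg hm₀.le (Real.rpow_nonneg (pow_nonneg (Nat.cast_nonneg _) _) _)
    have key := hasMaj_ofBlocks_of_massLimit (g := unitTorusGeoS L K M Msz) (blockOf (L ^ K) M) (blockOf (L ^ K) M ∘ underPtN L K n M)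
      (fun m2 : ℝ => idef (pull (underPtN L K n M)) (pull (underPtN L K n M)) (kingGOp L a m2 (K + n) (L ^ n * L ^ K) M) (kingGOp L a m2 K (L ^ K) M))
      (fun y y' => m₀ * ((L : ℝ) ^ K) ^ (-(γ / 2)) * Real.exp (-(δ₂ * tdistT M y y'))) one_pos
      (fun μ x => continuousAt_idef_kingGOp_mass M L hL1 ha hK n μ x) fun m hm hm1 => H2 K hK n hn e M hM m hm hm1 Msz
    exact key.mono fun y y' => mul_le_mul_of_nonneg_left
      (Real.exp_le_exp.mpr (neg_le_neg (mul_le_mul_of_nonneg_right (min_le_right _ _) (tdistT_nonneg M y y')))) hθ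

end Letters

/-! ## §4 ★★ THE HONEST DICTIONARY: the `U ≡ 1` site form of record `Q′G′²Q′* = qggqRe n a M` IS `siteForm₀ blockOf G′` for the massless scalar propagator `G′ = A₀(a, n², 0)⁻¹` -/

section Dictionary

variable (M : Fin (d + 1) → ℕ) [∀ μ, NeZero (M μ)] (n : ℕ) [NeZero n]

/-- the indicator of King's unit block `B(b)` pulled back to the fine torus: `pull blockOf δ_b = 1_{B(b)}`. [folklore] -/
theorem pull_blockOf_single (b : Tor M) : pull (blockOf n M) (Pi.single b (1 : ℝ)) = fun z => if blockOf n M z = b then 1 else 0 := by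
  funext z
  rw [pull_apply]
  by_cases h : blockOf n M z = b
  · rw [h, Pi.single_eq_same, if_pos rfl]
  · rw [Pi.single_eq_of_ne h, if_neg h]

/-- King's minimiser at a unit-lattice source `φ` IS `a·A₀⁻¹(φ ∘ blockOf)`: `ℋφ = (a·n^{d+1})·A₀⁻¹Qᵀφ` and `Qᵀφ = n^{−(d+1)}·(φ ∘ blockOf)`. [cite: King1986, (2.13)–(2.15) p.653] -/
theorem minimiser_eq_smul_inv_mulVec_pull (a c m2 : ℝ) (φ : Tor M → ℝ) :
    minimiser n M a c m2 φ = a • ((fineOp n M a c m2)⁻¹ *ᵥ pull (blockOf n M) φ) := by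
  have hn : (0 : ℝ) < (n : ℝ) ^ (d + 1) := pow_pos (Nat.cast_pos.mpr (Nat.pos_of_ne_zero (NeZero.ne n))) _
  have hQ : ((Qmat n M)ᵀ *ᵥ φ) = ((n : ℝ) ^ (d + 1))⁻¹ • pull (blockOf n M) φ := by
    funext z
    rw [transpose_Qmat_mulVec, Pi.smul_apply, pull_apply, smul_eq_mul]
  rw [minimiser, hQ, Matrix.mulVec_smul, smul_smul, mul_assoc, mul_inv_cancel₀ hn.ne', mul_one]

/-- **b04's KERNEL `K_T = G′Q′*` IS THE MASSLESS PROPAGATOR ON BLOCK INDICATORS**: `K_T(x, b) = (A₀(a, n², 0)⁻¹1_{B(b)})(x)` (`a > 0`) — part 50 `KRe_torIdx_eq_minimiser` with the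
factor `a⁻¹·a` cancelled. [cite: Balaban1984PropagatorsI, p.25 («G′Q′^*ω»); King1986, (2.13)–(2.15) p.653] -/
theorem KRe_torIdx_eq_inv_mulVec_indicator {a : ℝ} (ha : 0 < a) (x : Tor (fine n M)) (b : Tor M) :
    KRe n a M (torIdx (fine n M) x) (torIdx M b) = ((fineOp n M a ((n : ℝ) ^ 2) 0)⁻¹ *ᵥ pull (blockOf n M) (Pi.single b 1)) x := by
  rw [KRe_torIdx_eq_minimiser M n ha x b, minimiser_eq_smul_inv_mulVec_pull, Pi.smul_apply, smul_eq_mul, ← mul_assoc, inv_mul_cancel₀ ha.ne', one_mul]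

/-- the propagator is SYMMETRIC entrywise: `A₀⁻¹(x, z) = A₀⁻¹(z, x)` — dag-n15-e Ψ-e `fineOp_inv_transpose` (`(A₀⁻¹)ᵀ = A₀⁻¹`) read at one entry. [cite: King1986, (4.4) p.670] -/
theorem fineOp_inv_apply_comm (a c m2 : ℝ) (x z : Tor (fine n M)) : (fineOp n M a c m2)⁻¹ x z = (fineOp n M a c m2)⁻¹ z x := by
  rw [← Matrix.transpose_apply ((fineOp n M a c m2)⁻¹) z x, fineOp_inv_transpose]

/-- the block sum of a propagator column is the propagator on the block indicator: `Σ_{x ∈ B(b)} A₀⁻¹(x, z) = (A₀⁻¹1_{B(b)})(z)` (symmetry). [folklore] -/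
theorem sum_fibre_fineOp_inv_apply (a c m2 : ℝ) (b : Tor M) (z : Tor (fine n M)) :
    ∑ x ∈ fibre (blockOf n M) b, (fineOp n M a c m2)⁻¹ x z = ((fineOp n M a c m2)⁻¹ *ᵥ fun x => if blockOf n M x = b then 1 else 0) z := by
  classical
  rw [Matrix.mulVec, dotProduct, fibre, Finset.sum_filter]
  refine Finset.sum_congr rfl fun x _ => ?_
  rw [fineOp_inv_apply_comm M n a c m2 x z]
  split_ifs <;> simp

/-- ★★ **THE HONEST DICTIONARY** — the `U ≡ 1` site form the sockets of parts II∕IV perturb IS the lineage's `siteForm₀` of the massless scalar propagator: for every fineness `n ≥ 1`,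
coupling `a > 0` and unit torus `M`,
`siteEntries M (siteForm₀ (blockOf n M) (A₀(a, n², 0)⁻¹)) = qggqRe n a M`, i.e. `(Q′G′²Q′*)(k, k′) = [Q∘G′∘G′∘Q*](δ_{k′})(k)` with `Q` = the block MEAN (`fibAvg blockOf`, `n^{d+1}` fine sites
per block — `card_fibre_blockOf`) and `Q* = pull blockOf` — b05's Gram identity `gram_entry_eq` (`N(k,k′) = η^{d+1}Σ_x K_T(x,k)K_T(x,k′)`), `K_T = G′1_{B(·)}` (above) and the symmetry of `G′`.
So part V's `sitePert365 blockOf G′ X(U) = siteForm blockOf 0 0 X(U) − siteForm₀ blockOf G′` perturbs LITERALLY [B5]'s `Q′G′²Q′*` of (1.45) when `G′` is this file's massless layer.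
[cite: Balaban1984PropagatorsI, p.25 («⟨ω, Q′_kG′_k²Q′_k^*ω⟩ = ‖G′_kQ′_k^*ω‖²»), (1.45) p.26; Balaban1985BackgroundPropagators, Thm 3.2 (3.48) p.398 (the operator inverted)] -/
theorem siteEntries_siteForm₀_fineOp_inv {a : ℝ} (ha : 0 < a) :
    siteEntries M (siteForm₀ (blockOf n M) (Matrix.mulVecLin (fineOp n M a ((n : ℝ) ^ 2) 0)⁻¹)) = qggqRe n a M := by
  classical
  ext p q
  set G : Matrix (Tor (fine n M)) (Tor (fine n M)) ℝ := (fineOp n M a ((n : ℝ) ^ 2) 0)⁻¹ with hG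
  obtain ⟨bp, rfl⟩ : ∃ b, torIdx M b = p := ⟨(torIdx M).symm p, (torIdx M).apply_symm_apply p⟩
  obtain ⟨bq, rfl⟩ : ∃ b, torIdx M b = q := ⟨(torIdx M).symm q, (torIdx M).apply_symm_apply q⟩
  rw [gram_entry_eq M n ha]
  simp only [KRe_torIdx_eq_inv_mulVec_indicator M n ha, pull_blockOf_single]
  rw [siteEntries, Equiv.symm_apply_apply, Equiv.symm_apply_apply, entry_apply, siteForm₀, LinearMap.comp_apply, LinearMap.comp_apply, LinearMap.comp_apply,
    BackgroundLayer.fibAvg_apply, card_fibre_blockOf, pull_blockOf_single, div_eq_inv_mul]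
  push_cast
  congr 1
  -- `Σ_{x ∈ B(b_p)} (G(G1_{B_q}))(x) = Σ_z (G1_{B_p})(z)·(G1_{B_q})(z)`
  simp only [Matrix.mulVecLin_apply]
  have hx : ∀ x : Tor (fine n M), (G *ᵥ (G *ᵥ fun z => if blockOf n M z = bq then (1 : ℝ) else 0)) x =
      ∑ z, G x z * (G *ᵥ fun z => if blockOf n M z = bq then (1 : ℝ) else 0) z := fun x => rfl
  simp only [hx]
  rw [Finset.sum_comm]
  refine Finset.sum_congr rfl fun z _ => ?_
  rw [← Finset.sum_mul, sum_fibre_fineOp_inv_apply M n]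

/-- … and for the site sockets' member: `siteEntries M (siteForm₀ (blockOf (L^K) M) (kingGOp L a 0 K (L^K) M)) = qggqRe (L^K) (aK a L K) M` — the coarse run of part IV's `sSiteExOn` at
`U ≡ 1` (its fine run is the same statement at `K + n`, `L^nL^K`); `K ≥ 1`, `L > 1`, `a > 0`. [cite: Balaban1984PropagatorsI, (1.45) p.26; King1986, (2.15) p.653] -/
theorem siteEntries_siteForm₀_kingGOp_zero (L : ℕ) (hL : 1 < L) {a : ℝ} (ha : 0 < a) {K : ℕ} (hK : 1 ≤ K) (N : ℕ) [NeZero N] :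
    siteEntries M (siteForm₀ (blockOf N M) (kingGOp L a 0 K N M)) = qggqRe N (aK a L K) M := by
  have hLr : (1 : ℝ) < (L : ℝ) := by exact_mod_cast hL
  rw [kingGOp]
  exact siteEntries_siteForm₀_fineOp_inv M N (aK_pos ha hLr hK)

end Dictionary

end Summit.QuantumFields.YangMills.BalabanUVNodes.N15.SiteLayerBg

end
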